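import Mathlib.AlgebraicGeometry.Geometrically.Connected
import HarnessLib

/-!
# Geometric connectedness descends along a surjection of the source
# (EGA IV₂ 4.5.13 / Stacks 0387: images of geometrically connected fibres)

If `π : A → Q` is a SURJECTIVE morphism of schemes and the composite `A → Q → S` has geometrically
connected fibres (Mathlib `GeometricallyConnected`), then so does `Q → S`: for a field-valued point
`y : Spec K → S`, the fibre `Q ×_S Spec K` receives the surjection (a base change of `π`) from the fibre
`A ×_S Spec K ≅ A ×_Q (Q ×_S Spec K)`, which is connected, and the continuous image of a connected space
is connected. Used for the quotient `A → A/K` of an abelian scheme by a finite group of translations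
(the fibres of `A/K → S` are geometrically connected because those of `A → S` are).
Everything is proved; no named facts, no definitions.

Mathlib searched (pin): `GeometricallyConnected`, `geometrically_iff_of_isClosedUnderIsomorphisms`,
`pullback_of_geometrically`, `pullbackRightPullbackFstIso`, `Function.Surjective.connectedSpace`
(all used); Mathlib has `GeometricallyConnected.comp` but not this cancellation.

## References

* A. Grothendieck, *EGA IV₂*, Prop. 4.5.13; The Stacks Project, Tag 0387 / 054N. [StacksProject]
-/

noncomputable section

universe u

open CategoryTheory Limits AlgebraicGeometry

namespace Literature.AlgebraicGeometry.Morphisms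

/-- **Geometric connectedness of the fibres descends along a surjection of the source**: if `π : A → Q`
is surjective and `π ≫ g : A → S` is geometrically connected, then `g : Q → S` is geometrically
connected (every fibre `Q_ȳ` is the continuous image of the connected `A_ȳ`).
[cite: StacksProject, Tag 0387] -/
theorem geometricallyConnected_of_surjective_comp {A Q S : Scheme.{u}} (π : A ⟶ Q) (g : Q ⟶ S)
    [Surjective π] [GeometricallyConnected (π ≫ g)] : GeometricallyConnected g := by
  refine ⟨(geometrically_iff_of_isClosedUnderIsomorphisms (P := (ConnectedSpace ·)) (f := g)).mpr
    fun K _ y => ?_⟩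
  -- the fibre of `π ≫ g` over `y` is connected …
  have h : ConnectedSpace ↥(pullback (π ≫ g) y) :=
    pullback_of_geometrically (GeometricallyConnected.geometrically_connectedSpace (f := π ≫ g)) K y
  -- … it is `A ×_Q (Q ×_S Spec K)` …
  haveI : ConnectedSpace ↥(pullback π (pullback.fst g y)) :=
    (pullbackRightPullbackFstIso g y π).hom.homeomorph.connectedSpace_iff.mpr h
  -- … which surjects onto the fibre of `g` over `y` by the base change of `π`
  exact (pullback.snd π (pullback.fst g y)).surjective.connectedSpace
    (pullback.snd π (pullback.fst g y)).continuous

end Literature.AlgebraicGeometry.Morphisms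

end
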